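import Summits.BirchSwinnertonDyer.BirchSwinnertonDyer.Theorems.SchneiderFreeAdditiveX3SemistableTwistLocalThree
import Literature.NumberTheory.EllipticCurves.GaloisActionProofs
import Literature.NumberTheory.GaloisRepresentations.FrobeniusGeneration
import Literature.NumberTheory.Automorphic.BCDTTheoremBWildAtThreeTwist
import HarnessLib

/-!
# Route `SchneiderFreeAdditiveX3` (K1 door), NEGATIVE companion at `p = 3`: for an ANOMALOUS twist (`3 ∣ a_3(V) − 1`) CGLS's local
# hypothesis FAILS at every rational line of `W = V ⊗ χ_{−3}` — the non-anomalous clause of `…SemistableTwistLocalThree` is SHARP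

Cell `bsd-schneider-ideate`, seat `bsd-schneider-door-c5` (prover, generation 25; assembly layer; `--supports` 19177).
PARTITION: board row B6 ∩ X3 ∩ sst-twist, `r = 1`, (G-ord, `e = 2`) half at `p = 3` (2 411 pairs) of `Rank1Residual.partition`; a TYPED
OBSTRUCTION (negative lemma) for the 1 725 ANOMALOUS pairs of that cell (census kit j319291): there the hypothesis «`θ|_{G_v̄} ∉ {𝟙, ω}`» of
Castella–Grossi–Lee–Skinner 2022 Prop. 14 is FALSE for the residual characters, so the published-fact road of generations 23–25 ([INV.μ] from
Prop. 14) cannot serve them; types-the-object-of nothing; closes none of B6's cells (BSD NOT advanced). bears_on: K1-door (19177 r3).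

WHAT.  `V/ℚ` globally minimal, good ORDINARY at `3` with `3 ∣ a_3(V) − 1` (ANOMALOUS), `W = C • V^{(−3)}` with `W[3]` reducible.  Then the clause
`hna` of the companion files FAILS: there are a prime `𝔓 ∣ 3` and a rational line `Φ ≤ W[3]` such that `D_𝔓` fixes `Φ` pointwise OR acts
trivially on `W[3]/Φ`.  Indeed `E[3]|_{D_𝔓} ~ (α⁻¹ ∗; 0 ωα)` and `α = 𝟙` on `D_𝔓`: with `K` the kernel-of-reduction line, EVERY `g ∈ D_𝔓` acts
trivially on `V[3]/K` (`g = σⁿ·i·u`, Frobenius generation over the open kernel of `ρ̄_{V,3}`; `σ` acts on the reduction by `a_3 ≡ 1`, inertia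
trivially) and hence by `χ̄_3(g)` on `K` (determinant); since `ε_{−3}(g) = χ̄_3(g)` EXACTLY (`ζ_3 = (−1 + √−3)/2`), the twisted action fixes
`e⁻¹(K)` pointwise and is trivial on `W[3]/Φ` for every `D`-stable line `Φ ≠ e⁻¹(K)`; a rational line is one or the other.

* §1 `modPCyclotomicCharacterZMod_three_eq_one_iff` (`χ̄_3(g) = 1 ↔ g√−3 = √−3`); §2 `exists_kernelLine_of_anomalous`
  (odd `p`, `p ∣ a_p(V) − 1`: a line `K ≤ V[p]` at the place's prime with `g x − x ∈ K` for ALL `g ∈ D_𝔓`); §3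
  **`not_hna_of_goodOrd_negThree_twist_of_anomalous`** and the cell form **`not_hna_of_classX3_of_subGordTwo_of_exists_anomalous_twist`**.

HONEST FRAMING: theorems only; a NEGATIVE statement about a HYPOTHESIS (CGLS Prop. 14's local clause), not about any conjecture: nothing is
refuted, no main conjecture or BSD statement is touched; for these pairs Keller–Yin 2402.12781 §1 (anomalous case) / the x1 cell's road remain the
texts; «closes rung: none».  References: Serre 1972 §1.11 [Serre1972]; Mazur 1972 §1 [Mazur1972]; Neukirch *ANT* I §9 (9.4) [NeukirchANT1999];
CGLS 2022 §1.2 [CastellaGrossiLeeSkinner2022]; Keller–Yin arXiv:2402.12781 §1 [KellerYin2024].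
-/

set_option autoImplicit false
set_option linter.dupNamespace false -- the summit namespace `…BirchSwinnertonDyer.BirchSwinnertonDyer.Theorems` (Sub = Summit, D-0017) trips it

noncomputable section

open scoped Classical NumberField Pointwise

open WeierstrassCurve NumberField IsDedekindDomain Field Rat.HeightOneSpectrum
  Literature.NumberTheory.EllipticCurves Literature.NumberTheory.GaloisRepresentations
  Literature.NumberTheory.EllipticCurves.Rank1Residual
  Summit.BirchSwinnertonDyer.Rank1Residual Summit.BirchSwinnertonDyer.Rank1Residual.GaloisImage
  Summit.BirchSwinnertonDyer.Rank1Residual.Additive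
  Summit.BirchSwinnertonDyer.BirchSwinnertonDyer.Theorems.SchneiderFreeAdditiveX3.SemistableTwistLocal

namespace Summit.BirchSwinnertonDyer.BirchSwinnertonDyer.Theorems.SchneiderFreeAdditiveX3.SemistableTwistLocalThree

/-! ### §1 `ε_{−3} = χ̄_3` exactly -/

/-- **`χ̄_3(g) = 1 ↔ g√−3 = √−3`** (`ℚ(ζ_3) = ℚ(√−3)`: `ζ = (−1 + √−3)/2` is a primitive cube root of unity, `g ζ = ζ^{χ̄_3(g)}`, and
`ζ² = (−1 − √−3)/2 ≠ ζ`).  The direction `→` is `smul_geomSqrt_pStar_eq_of_modPCyclotomicCharacterZMod_eq_one` at `p = 3` (`p* = −3`).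
[cite: IrelandRosen1990, Prop. 6.3.2] -/
theorem modPCyclotomicCharacterZMod_three_eq_one_iff (g : absoluteGaloisGroup ℚ) :
    modPCyclotomicCharacterZMod ℚ 3 g = 1 ↔ g • geomSqrt (-3 : ℚ) = geomSqrt (-3 : ℚ) := by
  have h3 : ((-1 : ℚ) ^ (3 / 2)) * (3 : ℕ) = -3 := by norm_num
  refine ⟨fun h ↦ by simpa only [h3] using smul_geomSqrt_pStar_eq_of_modPCyclotomicCharacterZMod_eq_one 3 (by norm_num) h, fun h ↦ ?_⟩
  -- `ζ = (−1 + s)/2`, `s = √−3`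
  set s : AlgebraicClosure ℚ := geomSqrt (-3 : ℚ) with hs
  have hs2 : s ^ 2 = -3 := by rw [hs, geomSqrt_sq, map_neg, map_ofNat]
  set ζ : AlgebraicClosure ℚ := (-1 + s) / 2 with hζ
  have hζ3 : ζ ^ 3 = 1 := by
    rw [hζ]
    have : ((-1 + s) / 2) ^ 3 = (-1 + 3 * s - 3 * s ^ 2 + s ^ 2 * s) / 8 := by ring
    rw [this, hs2]; ring
  have hζ1 : ζ ≠ 1 := by
    intro h1
    have : s = 3 := by rw [hζ] at h1; linear_combination 2 * h1
    rw [this] at hs2; norm_num at hs2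
  -- `g ζ = ζ` since `g s = s`
  have h' : absoluteGaloisGroup.toAlgEquiv ℚ g s = s := by
    have h'' := h
    rwa [absoluteGaloisGroup.smul_def] at h''
  have hgζ : g • ζ = ζ := by
    rw [hζ, absoluteGaloisGroup.smul_def, map_div₀, map_add, map_neg, map_one, map_ofNat, h']
  -- `χ̄_3(g).val ∈ {1, 2}` and `ζ^{val} = ζ`
  haveI : NeZero ((3 : ℕ) : ℚ) := ⟨by norm_num⟩
  have hspec := modNCyclotomicCharacter_spec ℚ 3 g ζ hζ3
  rw [← modPCyclotomicCharacterZMod_eq_modNCyclotomicCharacter, hgζ] at hspec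
  rcases ZMod.units_three_eq_one_or (modPCyclotomicCharacterZMod ℚ 3 g) with h1 | h2
  · exact h1
  · exfalso
    rw [h2, Units.val_neg, Units.val_one] at hspec
    have hval : (-1 : ZMod 3).val = 2 := by decide
    rw [hval] at hspec
    -- `ζ = ζ²` forces `ζ (ζ - 1) = 0`, `ζ ∈ {0, 1}`, both absurd
    have hζ0 : ζ ≠ 0 := fun h0 ↦ by rw [h0, zero_pow (by norm_num)] at hζ3; exact zero_ne_one hζ3
    have : ζ * (ζ - 1) = 0 := by linear_combination (-1 : AlgebraicClosure ℚ) * hspec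
    rcases mul_eq_zero.mp this with h0 | h0
    · exact hζ0 h0
    · exact hζ1 (sub_eq_zero.mp h0)

/-! ### §2 The kernel-of-reduction line of an ANOMALOUS good ordinary curve: the whole decomposition group is trivial on the quotient -/

section Kernel

variable {V : WeierstrassCurve ℚ} [V.IsElliptic] [V.IsGloballyMinimal] {p : ℕ} [hp : Fact p.Prime]

/-- **At an ANOMALOUS good prime (`p ∣ a_p(V) − 1`, `p` odd; then `p ∤ a_p`, ordinary): a line `K ≤ V[p]` (the kernel of reduction) at a
prime `𝔓 ∣ p` such that EVERY `g ∈ D_𝔓` acts trivially on `V[p]/K`** (`g x − x ∈ K`).  Frobenius generation `g = σⁿ·i·u` over the open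
kernel `U` of `ρ̄_{V,p}` (tree `exists_eq_frobenius_pow_mul_of_mem_decompositionSubgroup`, `isOpen_ker_galoisRepTorsion_holds`); `σ` acts on
the reduction of `V[p]` trivially when `a_p ≡ 1` (`geomReduction_smul_eq_self_of_dvd_frobeniusTrace_sub_one`), inertia always does.  `#K = p` as in
`exists_kernelLine_frobenius`. [cite: Serre1972, §1.11 (1)] [cite: Mazur1972, §1 (anomalous primes)] [cite: NeukirchANT1999, I §9 Prop. (9.4)] -/
theorem exists_kernelLine_of_anomalous (hp2 : p ≠ 2) (hgood : V.HasGoodReductionAtPrime p) (han : (p : ℤ) ∣ V.frobeniusTrace p - 1)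
    {v : HeightOneSpectrum (𝓞 ℚ)} (hpv : ((p : ℕ) : 𝓞 ℚ) ∈ v.asIdeal) :
    ∃ 𝔓 ∈ v.primesAbove, ∃ K : AddSubgroup (geomTorsion V (p : ℤ)), Nat.card K = p ∧
      ∀ g ∈ 𝔓.decompositionSubgroup (absoluteGaloisGroup ℚ), ∀ x : geomTorsion V (p : ℤ), g • x - x ∈ K := by
  have hpP : p.Prime := hp.out
  haveI : NeZero p := ⟨hpP.ne_zero⟩
  have hord : ¬ (p : ℤ) ∣ V.frobeniusTrace p := by
    intro h
    have h1 : (p : ℤ) ∣ 1 := by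
      have := dvd_sub h han
      rwa [sub_sub_cancel] at this
    exact hpP.ne_one (by exact_mod_cast Int.eq_one_of_dvd_one (by positivity) h1)
  have hv : (primesEquiv v : ℕ) = p := by
    have h : natGenerator v ∣ p := by
      rw [natGenerator_dvd_iff, ← map_natCast (Rat.IsIntegralClosure.intEquiv (𝓞 ℚ)) p]
      exact Ideal.mem_map_of_mem _ hpv
    exact (Nat.prime_dvd_prime_iff_eq (prime_natGenerator v) hpP).mp h
  have hΔ : ¬ (p : ℤ) ∣ minimalDiscriminantInt V := V.not_dvd_minimalDiscriminantInt_of_hasGoodReductionAtPrime' p hgood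
  obtain ⟨𝔓, hmem, h𝔓⟩ := exists_ideal_placeOver p hv
  obtain ⟨σ, hσ⟩ := HeightOneSpectrum.exists_isArithFrobAt_of_mem_primesAbove_holds (K := ℚ) (v := v) h𝔓
  set f : geomTorsion V (p : ℤ) →+ (reductionModPrime V p).geomPoints :=
    (geomReduction hΔ).comp (geomTorsion V (p : ℤ)).subtype with hf
  set K : AddSubgroup (geomTorsion V (p : ℤ)) := f.ker with hK
  have hmemK : ∀ x : geomTorsion V (p : ℤ), x ∈ K ↔ geomReduction hΔ (x : V.geomPoints) = 0 := fun x ↦ by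
    rw [hK, AddMonoidHom.mem_ker]; rfl
  have hxp : ∀ x : geomTorsion V (p : ℤ), (p : ℤ) • (x : V.geomPoints) = 0 := fun x ↦
    (Submodule.mem_torsionBy_iff _ _).mp x.2
  have hKI : ∀ τ ∈ 𝔓.inertia (absoluteGaloisGroup ℚ), ∀ x : geomTorsion V (p : ℤ), τ • x - x ∈ K := by
    intro τ hτ x
    rw [hmemK, AddSubgroup.coe_sub, AddSubgroup.torsionBy.coe_smul, map_sub,
      geomReduction_smul_of_mem_inertia hΔ hmem hτ, sub_self]
  -- `σⁿ` acts trivially on the reduction of `V[p]`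
  have hσn : ∀ (n : ℕ) (x : geomTorsion V (p : ℤ)),
      geomReduction hΔ ((σ ^ n) • (x : V.geomPoints)) = geomReduction hΔ (x : V.geomPoints) := by
    intro n
    induction n with
    | zero => intro x; rw [pow_zero, one_smul]
    | succ n ih =>
      intro x
      rw [pow_succ', mul_smul]
      have hpx : (p : ℤ) • ((σ ^ n) • (x : V.geomPoints)) = 0 := by rw [smul_comm, hxp x, smul_zero]
      rw [geomReduction_smul_eq_self_of_dvd_frobeniusTrace_sub_one hΔ hmem hv h𝔓 hσ han _ hpx, ih]
  -- every `g ∈ D` is `σⁿ i u` with `u` in the kernel of `ρ̄`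
  have hU : IsOpen (((galoisRepTorsion V (p : ℤ)).ker : Subgroup (absoluteGaloisGroup ℚ)) : Set (absoluteGaloisGroup ℚ)) :=
    V.isOpen_ker_galoisRepTorsion_holds (n := (p : ℤ)) (by exact_mod_cast hpP.ne_zero)
  have hKD : ∀ g ∈ 𝔓.decompositionSubgroup (absoluteGaloisGroup ℚ), ∀ x : geomTorsion V (p : ℤ), g • x - x ∈ K := by
    intro g hg x
    obtain ⟨n, i, u, hi, hu, rfl⟩ := exists_eq_frobenius_pow_mul_of_mem_decompositionSubgroup h𝔓 hσ hU hg
    have hux : u • x = x := by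
      rw [MonoidHom.mem_ker] at hu
      rw [show u • x = Multiplicative.toAdd (galoisRepTorsion V (p : ℤ) u) x from rfl, hu]
      rfl
    have hgx : (σ ^ n * i * u) • x = (σ ^ n) • (i • x) := by rw [mul_smul, mul_smul, hux]
    rw [hmemK, hgx, AddSubgroup.coe_sub, AddSubgroup.torsionBy.coe_smul, map_sub, hσn n (i • x),
      AddSubgroup.torsionBy.coe_smul, geomReduction_smul_of_mem_inertia hΔ hmem hi, sub_self]
  -- `#K = p`
  obtain ⟨P, hP, hPred⟩ := exists_zsmul_eq_zero_geomReduction_ne_zero p hΔ hord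
  set T₁ : geomTorsion V (p : ℤ) := ⟨P, (Submodule.mem_torsionBy_iff _ _).mpr hP⟩ with hT₁def
  have hT₁K : T₁ ∉ K := by rw [hmemK]; exact hPred
  have hT₁ : T₁ ≠ 0 := by
    intro h0
    apply hPred
    have : (T₁ : V.geomPoints) = 0 := by rw [h0]; rfl
    rw [show P = (T₁ : V.geomPoints) from rfl, this, map_zero]
  have hKbot : K ≠ ⊥ := by
    intro hbot
    obtain ⟨τ, hτI, hτχ⟩ := exists_mem_inertia_modPCyclotomicCharacterZMod_eq p hpv h𝔓 (-1)
    have htriv : ∀ x : geomTorsion V (p : ℤ), τ • x = x := fun x ↦ by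
      have h := hKI τ hτI x
      rw [hbot, AddSubgroup.mem_bot, sub_eq_zero] at h
      exact h
    have h1 := intCast_eq_of_smul_eq_self_of_forall_sub_zsmul_mem V p hT₁ (htriv T₁) (a := 1)
      (fun x ↦ by rw [htriv, one_zsmul, sub_self]; exact AddSubgroup.zero_mem _)
    rw [hτχ, Units.val_neg, Units.val_one, Int.cast_one] at h1
    have h2 : ((2 : ℕ) : ZMod p) = 0 := by
      rw [show ((2 : ℕ) : ZMod p) = 1 + 1 by norm_num]
      nth_rw 1 [← h1]
      exact neg_add_cancel 1
    rw [ZMod.natCast_eq_zero_iff] at h2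
    exact hp2 ((Nat.prime_dvd_prime_iff_eq hpP Nat.prime_two).mp h2)
  have hcardV : Nat.card (geomTorsion V (p : ℤ)) = p ^ 2 := Rank1Residual.natCard_geomTorsion V p
  haveI : Finite (geomTorsion V (p : ℤ)) := Nat.finite_of_card_ne_zero (by rw [hcardV]; exact pow_ne_zero _ hpP.ne_zero)
  have hKcard : Nat.card K = p := by
    have hdvd : Nat.card K ∣ p ^ 2 := hcardV ▸ K.card_addSubgroup_dvd_card
    obtain ⟨i, hi, hKi⟩ := (Nat.dvd_prime_pow hpP).mp hdvd
    interval_cases i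
    · exact absurd (AddSubgroup.eq_bot_of_card_eq K (by rw [hKi, pow_zero])) hKbot
    · rw [hKi, pow_one]
    · exfalso
      apply hT₁K
      rw [AddSubgroup.eq_top_of_card_eq K (by rw [hKi, hcardV])]
      exact AddSubgroup.mem_top _
  exact ⟨𝔓, h𝔓, K, hKcard, hKD⟩

end Kernel

/-! ### §3 The negative lemma at `p = 3` -/

section Negative

variable {V W : WeierstrassCurve ℚ} [V.IsElliptic] [V.IsGloballyMinimal] [W.IsElliptic]

/-- **For an ANOMALOUS good-ordinary `V` at `3` and `W = C • V^{(−3)}` with `W[3]` reducible, CGLS's local clause FAILS:** there are a place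
`v ∋ 3`, a prime `𝔓 ∣ v` and a rational line `Φ ≤ W[3]` such that `D_𝔓` fixes `Φ` pointwise or acts trivially on `W[3]/Φ` — the negation of
the `hna` binder of generations 23–25.  (`D_𝔓` acts on `W[3]` through `(1 ∗; 0 ω)`: §2, the determinant on `K`, and `ε_{−3} = χ̄_3` (§1) under
the sign-equivariant transport `e : W[3] ≃ V[3]`; a rational line is either `e⁻¹(K)` — fixed pointwise — or complementary to it — then `W[3]/Φ ≅
e⁻¹(K)` is trivial.)  [cite: Serre1972, §1.11] [cite: Mazur1972, §1] [cite: CastellaGrossiLeeSkinner2022, §1.2 (hypothesis θ|_{G_v̄} ≠ 𝟙, ω)] -/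
theorem not_hna_of_goodOrd_negThree_twist_of_anomalous (hgood : V.HasGoodReductionAtPrime 3)
    (han : (3 : ℤ) ∣ V.frobeniusTrace 3 - 1) (C : VariableChange ℚ) (hC : C • V.quadraticTwist (-3 : ℚ) = W) (hred : Red W 3) :
    ¬ ∀ (v : HeightOneSpectrum (𝓞 ℚ)), ((3 : ℕ) : 𝓞 ℚ) ∈ v.asIdeal →
      ∀ (Φ : AddSubgroup (geomTorsion W (3 : ℤ))), IsRationalLine W 3 Φ →
      ∀ 𝔓 ∈ v.primesAbove,
        (¬ ∀ g ∈ 𝔓.decompositionSubgroup (absoluteGaloisGroup ℚ), ∀ P ∈ Φ, g • P = P) ∧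
          (¬ ∀ g ∈ 𝔓.decompositionSubgroup (absoluteGaloisGroup ℚ),
            ∀ P : geomTorsion W (3 : ℤ), g • P - P ∈ Φ) := by
  intro hna
  have hpP : Nat.Prime 3 := Fact.out
  obtain ⟨v, hpv⟩ := Literature.NumberTheory.NumberFields.RingOfIntegers.exists_heightOneSpectrum_natCast_mem ℚ hpP
  obtain ⟨𝔓, h𝔓, K, hK, hKD⟩ := exists_kernelLine_of_anomalous (V := V) (p := 3) (by norm_num) hgood han hpv
  obtain ⟨Φ, hΦ⟩ := exists_isRationalLine_of_not_irr W 3 hred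
  obtain ⟨h1, h2⟩ := hna v hpv Φ hΦ 𝔓 h𝔓
  -- the sign-equivariant twisting isomorphism `e : W[3] ≃ V[3]` (sign `ε_{−3} = χ̄_3`)
  have hd0 : (-3 : ℚ) ≠ 0 := by norm_num
  have hC' : C⁻¹ • W = V.quadraticTwist (-3 : ℚ) := by rw [← hC, inv_smul_smul]
  obtain ⟨e, hpos, hneg⟩ := exists_signEquiv_of_twist (W := V) (Wd := W) (p := 3) hd0 C⁻¹ hC'
  set ΦV : AddSubgroup (geomTorsion V (3 : ℤ)) := Φ.map e.toAddMonoidHom with hΦV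
  have hmem : ∀ P, e P ∈ ΦV ↔ P ∈ Φ := fun P ↦ by
    rw [hΦV, AddSubgroup.mem_map_equiv, AddEquiv.symm_apply_apply]
  have hΦVcard : Nat.card ΦV = 3 :=
    (Nat.card_congr (Φ.equivMapOfInjective e.toAddMonoidHom e.injective).toEquiv).symm.trans hΦ.1
  have hstab : ∀ (σ : absoluteGaloisGroup ℚ), ∀ T ∈ ΦV, σ • T ∈ ΦV := by
    intro σ T hT
    obtain ⟨P, rfl⟩ : ∃ P, e P = T := ⟨e.symm T, e.apply_symm_apply T⟩
    have hP : P ∈ Φ := (hmem P).mp hT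
    by_cases hsg : σ • geomSqrt (-3 : ℚ) = geomSqrt (-3 : ℚ)
    · rw [← hpos σ hsg, hmem]; exact hΦ.2 σ P hP
    · have h1 : σ • e P = -e (σ • P) := by rw [hneg σ hsg, neg_neg]
      rw [h1, ← map_neg, hmem]; exact Φ.neg_mem (hΦ.2 σ P hP)
  -- how `g ∈ D` acts on `V[3]`: trivially on `V[3]/K`, by the sign `ε(g)` on `K`
  have hKact : ∀ g ∈ 𝔓.decompositionSubgroup (absoluteGaloisGroup ℚ), ∀ k ∈ K,
      (g • geomSqrt (-3 : ℚ) = geomSqrt (-3 : ℚ) → g • k = k) ∧ (¬ g • geomSqrt (-3 : ℚ) = geomSqrt (-3 : ℚ) → g • k = -k) := by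
    intro g hg k hk
    have hcyc := MixedCongruence.smul_eq_cyclotomic_zsmul_of_forall_sub_mem V 3 g hK (hKD g hg) hk
    refine ⟨fun hfix ↦ ?_, fun hmov ↦ ?_⟩
    · rw [hcyc, (modPCyclotomicCharacterZMod_three_eq_one_iff g).mpr hfix, Units.val_one, ZMod.val_one, Nat.cast_one, one_smul]
    · have hχ : modPCyclotomicCharacterZMod ℚ 3 g = -1 := by
        rcases ZMod.units_three_eq_one_or (modPCyclotomicCharacterZMod ℚ 3 g) with h | h
        · exact absurd ((modPCyclotomicCharacterZMod_three_eq_one_iff g).mp h) hmov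
        · exact h
      have hval : (-1 : ZMod 3).val = 2 := by decide
      rw [hcyc, hχ, Units.val_neg, Units.val_one, hval]
      have h3k : (3 : ℤ) • k = 0 := Subtype.ext ((Submodule.mem_torsionBy_iff _ _).mp k.2)
      have : ((2 : ℕ) : ℤ) • k = -k + (3 : ℤ) • k := by
        rw [show ((2 : ℕ) : ℤ) = -1 + 3 by norm_num, add_smul, neg_one_zsmul]
      rw [this, h3k, add_zero]
  rcases line_eq_or_inf_eq_bot hΦVcard hK with heq | hinf
  · -- `e(Φ) = K`: `D` fixes `Φ` pointwise
    apply h1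
    intro g hg P hP
    have hePK : e P ∈ K := heq ▸ (hmem P).mpr hP
    apply e.injective
    by_cases hsg : g • geomSqrt (-3 : ℚ) = geomSqrt (-3 : ℚ)
    · rw [hpos g hsg, (hKact g hg _ hePK).1 hsg]
    · rw [hneg g hsg, (hKact g hg _ hePK).2 hsg, neg_neg]
  · -- `e(Φ) ∩ K = 0`: `D` acts trivially on `W[3]/Φ`
    apply h2
    intro g hg P
    -- decompose `e P = a + k`
    have hne : ΦV ≠ K := fun h ↦ by
      rw [h, inf_idem] at hinf
      haveI : Finite K := Nat.finite_of_card_ne_zero (by rw [hK]; norm_num)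
      have := hK; rw [hinf, AddSubgroup.card_bot] at this; norm_num at this
    obtain ⟨-, hsup⟩ := SemistableTwistLocalAnyLine.inf_eq_bot_and_sup_eq_top_of_ne hpP
      (Rank1Residual.natCard_geomTorsion V 3) hΦVcard hK hne
    have hx : e P ∈ ΦV ⊔ K := by rw [hsup]; exact AddSubgroup.mem_top _
    obtain ⟨a, ha, k, hk, hak⟩ := AddSubgroup.mem_sup.mp hx
    -- `g a = a`: `g a − a ∈ ΦV ∩ K = 0`
    have hga : g • a = a := by
      have h3 : g • a - a ∈ ΦV ⊓ K := ⟨ΦV.sub_mem (hstab g a ha) ha, hKD g hg a⟩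
      rw [hinf, AddSubgroup.mem_bot, sub_eq_zero] at h3
      exact h3
    rw [← hmem, map_sub]
    by_cases hsg : g • geomSqrt (-3 : ℚ) = geomSqrt (-3 : ℚ)
    · rw [hpos g hsg, ← hak, smul_add, hga, (hKact g hg k hk).1 hsg, sub_self]
      exact ΦV.zero_mem
    · rw [hneg g hsg, ← hak, smul_add, hga, (hKact g hg k hk).2 hsg, neg_add, neg_neg]
      have : -a + k - (a + k) = -((2 : ℕ) • a) := by rw [two_nsmul]; abel
      rw [this]
      exact ΦV.neg_mem (ΦV.nsmul_mem ha 2)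

variable (W)

/-- **The (G-ord, `e = 2`) cell at `p = 3`: an ANOMALOUS good-ordinary `(−3)`-twist model kills the non-anomalous clause** — for the 1 725 of
2 411 census pairs with `a_3(E^{(−3)}) ≡ 1 (mod 3)` (kit j319291) the `hna` binder of generations 23–25 is FALSE, so CGLS 2022 Prop. 14 cannot be
invoked for them through this road (their residual characters are `{𝟙, ω}` on `D_𝔓`).  [cite: CastellaGrossiLeeSkinner2022, §1.2 Prop. 14 (hypothesis)]
[cite: KellerYin2024, §1 (the anomalous case θ|_{G_p} ∈ {𝟙, ω}) (arXiv:2402.12781v2)] [cite: Mazur1972, §1] -/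
theorem not_hna_of_classX3_of_exists_anomalous_twist (hX : ClassX3 W 3)
    (hex : ∃ (V : WeierstrassCurve ℚ) (_ : V.IsElliptic) (_ : V.IsGloballyMinimal) (C : VariableChange ℚ),
      GoodOrd V 3 ∧ C • V.quadraticTwist ((-1 : ℚ) ^ (3 / 2) * (3 : ℕ)) = W ∧ (3 : ℤ) ∣ V.frobeniusTrace 3 - 1) :
    ¬ ∀ (v : HeightOneSpectrum (𝓞 ℚ)), ((3 : ℕ) : 𝓞 ℚ) ∈ v.asIdeal →
      ∀ (Φ : AddSubgroup (geomTorsion W (3 : ℤ))), IsRationalLine W 3 Φ →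
      ∀ 𝔓 ∈ v.primesAbove,
        (¬ ∀ g ∈ 𝔓.decompositionSubgroup (absoluteGaloisGroup ℚ), ∀ P ∈ Φ, g • P = P) ∧
          (¬ ∀ g ∈ 𝔓.decompositionSubgroup (absoluteGaloisGroup ℚ),
            ∀ P : geomTorsion W (3 : ℤ), g • P - P ∈ Φ) := by
  obtain ⟨V, _, _, C, hV, hC, han⟩ := hex
  have h3 : ((-1 : ℚ) ^ (3 / 2)) * (3 : ℕ) = -3 := by norm_num
  rw [h3] at hC
  exact not_hna_of_goodOrd_negThree_twist_of_anomalous hV.1 han C hC hX.1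

end Negative

end Summit.BirchSwinnertonDyer.BirchSwinnertonDyer.Theorems.SchneiderFreeAdditiveX3.SemistableTwistLocalThree

end
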